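import Literature.Geometry.Riemannian.MetricFlowCorrespondenceChain
import Literature.Geometry.Riemannian.MetricFlowFDistanceTriangleFamily
import HarnessLib

/-!
# Completeness of the `𝔽`-distance from the limit within one correspondence
# (Bamler 2023, §5.4, Thm. 5.19, `J = ∅`, `H`-concentrated pairs)

R. Bamler, *Compactness theory of the space of super Ricci flows*, Invent. Math. 233 (2023), §5.4,
Theorem 5.19 (arXiv v1 Thm. 120): *"`(𝔽^J_I, d^J_𝔽)` is complete."* Its printed proof: *"Consider
a sequence of metric flow pairs `(𝒳^i, (μ^i_t)_{t ∈ I'^{,i}})` … that form a Cauchy sequence in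
`(𝔽^J_I, d^J_𝔽)`. After passing to a subsequence, we may assume that `d^J_𝔽((𝒳^i, (μ^i_t)),
(𝒳^{i+1}, (μ^{i+1}_t))) < 2^{-i}`. So we can find correspondences `ℭ^{i,i+1}` between
`𝒳^i, 𝒳^{i+1}` over `I` that are fully defined over `J` such that
`d^{ℭ^{i,i+1},J}_𝔽((𝒳^i, (μ^i_t)), (𝒳^{i+1}, (μ^{i+1}_t))) < 2^{-i}`. By an iterative application
of Lemma 5.15 … [and] a direct limit construction … we find a correspondence `ℭ` between
`𝒳¹, 𝒳², …` such that for any `i ∈ ℕ`, `d^{ℭ,J}_𝔽((𝒳^i, (μ^i_t)), (𝒳^{i+1}, (μ^{i+1}_t))) < 2^{-i}`.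
After passing to their completions, we may assume that the metric spaces `(Z_t, d^Z_t)` of the
correspondence `ℭ` are complete. By Lemma 5.20 there is a metric flow pair
`(𝒳^∞, (μ^∞_t)_{t ∈ I'^{,∞}})` over `I` that is fully defined over `J` such that for an
enlargement `ℭ'` of `ℭ`,
`d^J_𝔽((𝒳^i, (μ^i_t)), (𝒳^∞, (μ^∞_t))) ≤ d^{ℭ',J}_𝔽((𝒳^i, (μ^i_t)), (𝒳^∞, (μ^∞_t))) → 0`.
This finishes the proof."*

This file proves exactly this deduction, for `J = ∅`, `I = [a, T]` and `H`-concentrated pairs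
(the standing assumption of the compactness theory, under which the tree's triangle inequality
within a correspondence, `MetricFlowPair.fDistWithinFamily_triangle`, is available), taking
**Lemma 5.20** (arXiv v1 Lemma 121: a Cauchy sequence within one correspondence `ℭ` with complete
separable comparison spaces has an `H`-concentrated limit within an enlargement `ℭ'` of `ℭ`) as the
HYPOTHESIS `hL` of `completeness_of_limitWithin`; its conclusion is the completeness half of the
tree's `𝔽`-compactness assembly (`bamler_FCompactness_ricciFlow_of_totallyBounded_of_complete`,
`BamlerFCompactnessAssembly.lean`): a sequence `P n` of `H`-concentrated metric flow pairs over
`[a, T]` with `d_𝔽(P n, P (n+1)) < 2^{-n}` has an `H`-concentrated `d_𝔽`-limit with measurable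
exceptional set `[a, T] ∖ I'^{,∞}`. In the tree's vocabulary: the correspondences `ℭⁿ` with
`d^{ℭⁿ}_𝔽(P n, P (n+1)) < 2^{-n}` come from the infimum `MetricFlowPair.fDist`; the combined
correspondence `𝔇` with complete separable comparison spaces is
`MetricFlowPair.exists_familyCorrespondence_of_chain` (`MetricFlowCorrespondenceChain.lean`,
iterated Lemma 5.15 + direct limit + completion), with `d^{𝔇}_𝔽(P n, P (n+1)) ≤ d^{ℭⁿ}_𝔽 < 2^{-n}`;
the sequence is then uniformly Cauchy within `𝔇`,
`d^{𝔇}_𝔽(P i, P j) ≤ ∑_{i ≤ l < j} 2^{-l} ≤ 2 · 2^{-i}` (`fDistWithinFamily_le_of_chain`, Prop. 5.14;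
the diagonal `i = j` is estimated through `i + 1` by the triangle inequality and the symmetry
`fDistWithin_pair_comm`, and `i > j` by symmetry); Lemma 5.20 (`hL`) gives the limit `P∞` and the
enlargement `ℭ'`, fully defined over `∅`, within which `P n → P∞`, whence `d_𝔽(P n, P∞) → 0`
(`MetricFlowPair.FConvergesWithin.fDist_tendsto_of_fullyDefinedOver`).

## References

* R. H. Bamler, *Compactness theory of the space of super Ricci flows*, Invent. Math. 233 (2023),
  1121–1277 (arXiv:2008.09298), §5.2 Prop. 5.14, Lemma 5.15; §5.4, Thm. 5.19 (arXiv v1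
  Thm. 120) and its proof, Lemma 5.20 (arXiv v1 Lemma 121). [Bamler2023]
-/

noncomputable section

open Set MeasureTheory Filter TopologicalSpace Function
open scoped Topology ENNReal NNReal

namespace Literature.Geometry.Riemannian

/-- A tail of the geometric series: `∑_{i ≤ l < j} 2^{-l} ≤ 2 · 2^{-i}` in `ℝ≥0∞`. [folklore] -/
theorem sum_Ico_two_inv_pow_le (i j : ℕ) :
    ∑ l ∈ Finset.Ico i j, (2⁻¹ : ℝ≥0∞) ^ l ≤ 2 * 2⁻¹ ^ i := by
  rw [Finset.sum_Ico_eq_sum_range]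
  calc ∑ k ∈ Finset.range (j - i), (2⁻¹ : ℝ≥0∞) ^ (i + k)
      = 2⁻¹ ^ i * ∑ k ∈ Finset.range (j - i), 2⁻¹ ^ k := by
        simp only [pow_add, Finset.mul_sum]
    _ ≤ 2⁻¹ ^ i * ∑' k, 2⁻¹ ^ k := mul_le_mul_right (ENNReal.sum_le_tsum _) _
    _ = 2 * 2⁻¹ ^ i := by rw [ENNReal.tsum_geometric_two, mul_comm]

/-- `2 · 2^{-k} ≤ 2^{-N}` for `k ≥ N + 1`, in `ℝ≥0∞`. [folklore] -/
theorem two_mul_two_inv_pow_le {N k : ℕ} (hk : N + 1 ≤ k) :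
    (2 : ℝ≥0∞) * 2⁻¹ ^ k ≤ 2⁻¹ ^ N :=
  calc (2 : ℝ≥0∞) * 2⁻¹ ^ k ≤ 2 * 2⁻¹ ^ (N + 1) :=
      mul_le_mul_right (pow_le_pow_right_of_le_one' (ENNReal.inv_le_one.2 one_le_two) hk) _
    _ = 2⁻¹ ^ N := by
      rw [pow_succ, ← mul_assoc, mul_comm (2 : ℝ≥0∞), mul_assoc,
        ENNReal.mul_inv_cancel two_ne_zero ENNReal.ofNat_ne_top, mul_one]

/-- **Bamler 2023, Thm. 5.19 (arXiv v1 Thm. 120), `J = ∅`, for `H`-concentrated pairs, from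
Lemma 5.20 within one correspondence.** Assume (hypothesis `hL` = Lemma 5.20, arXiv v1 Lemma 121,
with the closedness of `H`-concentration) that every sequence of `H`-concentrated metric flow pairs
over `I₀` which is uniformly Cauchy over `J` within ONE correspondence `ℭ` over `I₀` with complete
separable comparison spaces, fully defined over `J`, has an `H`-concentrated limit `P∞`, fully
defined over `J`, with measurable `I₀ ∖ I'^{,∞}`, to which it `𝔽`-converges uniformly over `J`
within a correspondence `ℭ'` fully defined over `J`. Then every sequence `P n`, `n ∈ ℕ`, of
`H`-concentrated metric flow pairs over `[a, T]` with `d_𝔽(P n, P (n + 1)) < 2^{-n}` has an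
`H`-concentrated limit `P∞` over `[a, T]` with measurable `[a, T] ∖ I'^{,∞}` and
`d_𝔽(P n, P∞) → 0`. Proof as printed: correspondences `ℭⁿ` over `[a, T]` with
`d^{ℭⁿ}_𝔽(P n, P (n+1)) < 2^{-n}` (definition of `d_𝔽` as an infimum), combined into one
correspondence `𝔇` with complete separable comparison spaces
(`exists_familyCorrespondence_of_chain`: iterated Lemma 5.15, direct limit, completion) with
`d^{𝔇}_𝔽(P n, P (n+1)) < 2^{-n}`, hence `d^{𝔇}_𝔽(P i, P j) ≤ 2 · 2^{-min(i,j)}` (Prop. 5.14 along the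
chain, `fDistWithinFamily_le_of_chain`; diagonal through `i + 1`; symmetry), so the sequence is
uniformly Cauchy within `𝔇`; Lemma 5.20 gives `P∞`, `ℭ'` and `d_𝔽(P n, P∞) ≤ d^{ℭ',∅}_𝔽(P n, P∞) → 0`.
[cite: Bamler2023, §5.4, Thm 5.19 (arXiv v1 Thm 120)] -/
theorem completeness_of_limitWithin
    (hL : ∀ {I₀ : Set ℝ} {H : ℝ}, 0 ≤ H → ∀ (P : ℕ → MetricFlowPair.{0} I₀),
      (∀ n, (P n).flow.IsHConcentrated H) →
      ∀ (ℭ : MetricFlow.FamilyCorrespondence (fun n ↦ (P n).flow) I₀),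
      (∀ t, CompleteSpace (ℭ.Z t)) → (∀ t, TopologicalSpace.SeparableSpace (ℭ.Z t)) →
      ∀ {J : Set ℝ}, ℭ.FullyDefinedOver J →
      (∀ ε : ENNReal, 0 < ε → ∃ N, ∀ i ≥ N, ∀ j ≥ N,
        MetricFlowPair.fDistWithinFamily P ℭ i j J ≤ ε) →
      ∃ (Pinf : MetricFlowPair.{0} I₀)
        (ℭ' : MetricFlow.FamilyCorrespondence (fun o : Option ℕ ↦ (o.elim Pinf P).flow) I₀),
        Pinf.flow.IsHConcentrated H ∧ Pinf.FullyDefinedOver J ∧ MeasurableSet (I₀ \ Pinf.I') ∧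
          ℭ'.FullyDefinedOver J ∧ MetricFlowPair.FConvergesWithin P Pinf ℭ' J) :
    ∀ (H a T : ℝ), 0 ≤ H → a < T → ∀ P : ℕ → MetricFlowPair.{0} (Set.Icc a T),
      (∀ n, (P n).flow.IsHConcentrated H) → (∀ n, MeasurableSet (Set.Icc a T \ (P n).I')) →
      (∀ n, MetricFlowPair.fDist ∅ (P n) (P (n + 1)) < 2⁻¹ ^ n) →
      ∃ Pinf : MetricFlowPair.{0} (Set.Icc a T), Pinf.flow.IsHConcentrated H ∧
        MeasurableSet (Set.Icc a T \ Pinf.I') ∧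
        Filter.Tendsto (fun n ↦ MetricFlowPair.fDist ∅ (P n) Pinf) Filter.atTop (nhds 0) := by
  intro H a T hH _ P hP _ hfast
  -- Step 1: correspondences `ℭⁿ` between `𝒳ⁿ, 𝒳ⁿ⁺¹` over `[a, T]` with `d^{ℭⁿ}_𝔽 < 2^{-n}`
  have hex : ∀ n, ∃ ℭ : MetricFlow.Correspondence₂ (P n).flow (P (n + 1)).flow (Icc a T),
      MetricFlowPair.fDistWithin (P n) (P (n + 1)) ℭ ∅ < 2⁻¹ ^ n := by
    intro n
    obtain ⟨ℭ, hℭ⟩ := iInf_lt_iff.1 (hfast n)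
    obtain ⟨_, hlt⟩ := iInf_lt_iff.1 hℭ
    exact ⟨ℭ, hlt⟩
  choose ℭ hℭ using hex
  -- Step 2: one correspondence `𝔇` between all the flows, complete separable comparison spaces,
  -- with `d^{𝔇}_𝔽(P n, P (n+1)) ≤ d^{ℭⁿ}_𝔽(P n, P (n+1)) < 2^{-n}`
  obtain ⟨𝔇, h𝔇c, h𝔇s, -, -, -, h𝔇adm⟩ := MetricFlowPair.exists_familyCorrespondence_of_chain P ℭ
    (J := ∅) fun n ↦ ⟨empty_subset _, empty_subset _⟩
  have hstep : ∀ n, MetricFlowPair.fDistWithinFamily P 𝔇 n (n + 1) ∅ ≤ 2⁻¹ ^ n := fun n ↦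
    (MetricFlowPair.le_fDistWithin_iff.2 fun r h ↦
      MetricFlowPair.fDistWithin_le (h𝔇adm n r h)).trans (hℭ n).le
  have hP' : ∀ n, ∃ H, (P n).flow.IsHConcentrated H := fun n ↦ ⟨H, hP n⟩
  -- Step 3: the sequence is uniformly Cauchy within `𝔇`: `d^{𝔇}_𝔽(P i, P j) ≤ 2 · 2^{-i}`, `i ≤ j`
  have hkey : ∀ i j, i ≤ j → MetricFlowPair.fDistWithinFamily P 𝔇 i j ∅ ≤ 2 * 2⁻¹ ^ i := by
    intro i j hij
    rcases hij.eq_or_lt with rfl | hlt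
    · -- the diagonal, through `i + 1`
      calc MetricFlowPair.fDistWithinFamily P 𝔇 i i ∅
          ≤ MetricFlowPair.fDistWithinFamily P 𝔇 i (i + 1) ∅ +
              MetricFlowPair.fDistWithinFamily P 𝔇 (i + 1) i ∅ :=
            MetricFlowPair.fDistWithinFamily_triangle P 𝔇 i (i + 1) i (hP' i) (hP' (i + 1))
              (hP' i) ∅
        _ ≤ 2⁻¹ ^ i + 2⁻¹ ^ i :=
            add_le_add (hstep i) ((fDistWithin_pair_comm P 𝔇 i (i + 1) ∅).trans_le (hstep i))
        _ = 2 * 2⁻¹ ^ i := (two_mul _).symm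
    · exact (MetricFlowPair.fDistWithinFamily_le_of_chain P 𝔇 hP' hstep i j hlt).trans
        (sum_Ico_two_inv_pow_le i j)
  have hC : ∀ ε : ℝ≥0∞, 0 < ε → ∃ N, ∀ i ≥ N, ∀ j ≥ N,
      MetricFlowPair.fDistWithinFamily P 𝔇 i j ∅ ≤ ε := by
    intro ε hε
    obtain ⟨N, hN⟩ := ENNReal.exists_inv_two_pow_lt hε.ne'
    refine ⟨N + 1, fun i hi j hj ↦ ?_⟩
    rcases le_total i j with hij | hji
    · exact (hkey i j hij).trans ((two_mul_two_inv_pow_le hi).trans hN.le)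
    · exact ((fDistWithin_pair_comm P 𝔇 j i ∅).trans_le (hkey j i hji)).trans
        ((two_mul_two_inv_pow_le hj).trans hN.le)
  -- Step 4: Lemma 5.20 within `𝔇`, and `d_𝔽 ≤ d^{ℭ',∅}_𝔽 → 0`
  obtain ⟨Pinf, ℭ', hPinf, -, hmeas, hℭ'J, hconv⟩ :=
    hL hH P hP 𝔇 h𝔇c h𝔇s (J := ∅) (fun _ ↦ empty_subset _) hC
  exact ⟨Pinf, hPinf, hmeas, hconv.fDist_tendsto_of_fullyDefinedOver hℭ'J⟩

end Literature.Geometry.Riemannian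

end
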